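import Summits.QuantumFields.BalabanUV.T4Continuum.Support.ShellMeasureWilsonRemainderLevels
import Summits.QuantumFields.BalabanUV.T4Continuum.Support.ShellMeasurePlaquetteCubicCovBinders

/-!
# `T4Continuum.ShellMeasureWilsonRemainderLevelsCov` — row S65, junction J1 ON THE HOLDER'S `∇`-FREE PART `V0remCov`: the
# generic scaled ENDs of `ShellMeasureWilsonRemainderLevels` §2 FIRED on `R p := V0remCov τ U₀ (∂ p)` (f5d-a's cut, whose
# main term is b08's flat `cub`), so that the holder's f5d-b `Prop4Hyp.add` assembly at the live levels is ONE call

Cell `pub-balaban`, sub-cell `t4`, spine estimate NE7c (node U5b), NE7c ROUND-2 crew `t4-ne7c-formalise-*`, unit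
`b2b-balaban-t4-ne7c-formalise-leaf-03` gen 5; owner table `t4/b2b-balaban-t4-ne7c-p1/LEAVES-NE7c-P1.md` row **S65** (holder
`…-leaf-02` gen 8), junction **J1** (GO l.16188, OFFER l.16562, the holder's NOTE l.16574 «the ∇-free family to fire
f2b∕f2a∕f2c on at the live levels is `V0remCov τ U (bd p)` — κ's ε₀-coefficient 248∕3 instead of 32∕3; swap by name»).
ADDITIVE: imports this lineage's `ShellMeasureWilsonRemainderLevels` (generic §2: `etaScale`, `hcub_etaScale`,
`weighted_locGrad_etaScale_le`, `prop4Hyp_locGrad_etaScale_levels(_max)`) and leaf-02-g8's f5d-a file 2∕2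
`ShellMeasurePlaquetteCubicCovBinders` (p225058: `norm_V0remCov_le_of_bonds`, `V0remCov_add_single`, `analyticAt_V0remCov`)
ONLY; modifies nothing; [folklore]; 0 `def`, 0 `def … : Prop`, 0 sorry, 0 citation tags.  §0 adds two generic
`etaScale` identities for the assembly: `etaScale_add`, `etaScale_of_cubic` (`η⁻⁴·R(η·) = η⁻¹·R` for a cubic form),
and the `∇`-part's currency **`etaScale_cubT`**: `etaScale η (cubT Λ Pl w τ η U₀) = cubT Λ Pl (η⁻¹·w) τ η U₀` (`cub_smul`,
`cubT_smul`: leaf-05's density is a cubic form) — with f5d-a's `w = iη∕2` the live-level `∇`-part is `cubT Λ Pl (i∕2) τ η U₀`.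

HONEST FRAMING.  Finite four-torus programme, rung (B)+1 only — NOT infinite volume, NOT a mass gap, NOT the Clay
problem, NOT summit progress; (B), `BetaPertHyp`, (B^μ) are not consumed.  NE7c (`T4IndicatorShell.ShellWeightBound`)
is NOT PRINTED and NOT PROVED; «NE7c ⇐ the named binders» (WALL `t4/b2b-balaban-t4-ne7c-p1/WALL-NE7c-P1.md` §2).
Nothing of [Balaban1985Variational] (= cell paper B11) is asserted: (38)–(40), (97)–(98) are LOCATORS for the SHAPE (the
paper is under adjudication).  HONEST DEPENDENCY (cell, verbatim): continuum YM on T⁴ ⇐ BetaPertH ∧ nine spine estimates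
(0/9 proved); BetaPertH ⇐ (D1) ∧ (D4) ∧ CAP+tail; G-an2-4 gates asym, D1 and NE2/3/4.

WHAT IS PROVED (every `τ : 𝔸 →L[ℂ] ℂ`; boundaries oriented `(+, +, −, −)` as in f5d-a §1 — b08's `p_{μν}(x)`):
* `raw_V0remCov`: f5d-a's bound in §2's raw shape, `a p = ‖τ‖·248∕3·‖U₀(∂p) − 1‖`, `c = ‖τ‖·40∕3`;
* `hcub_V0remCov_eta`: f2b's LITERAL `hcub` for `etaScale η (V0remCov τ U₀ ∂p)` at weight `W p`, under `0 < η ≤ W p`, the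
  per-plaquette regularity **`‖U₀(∂p) − 1‖ ≤ ε₀·(η∕W p)²`** ((38)'s hidden `η²` — a DISPLAYED BINDER) and `4ε ≤ 1`, with
  **`κ = ‖τ‖·(248∕3·ε₀ + 40∕3·ε)`** ((40)'s SHAPE);
* **`weighted_locGrad_V0remCov_eta_le`** ((97) bond by bond), **`prop4Hyp_locGrad_V0remCov_eta_levels`** ((98) from
  `WSup w 1 𝔸`), **`prop4Hyp_locGrad_V0remCov_eta_levels_max`** ((98) from f2c's `WMax w w′ Dv`, ANY `∇`-datum — the
  summand of the holder's f5d-b `Prop4Hyp.add` next to f5c's `prop4Hyp_locGrad_cubT_levels`): constant `8κ·m·Lc⁴`,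
  radius `ε∕2`, VOLUME-FREE (no `#Pl`, `#Λ`), k-UNIFORM (no number of scales).
NOT HERE: the `∇`-part and the assembly (f5c, f5d-b), the HD-dressing (S66), the identification with Bałaban's sectioned
`V₀′` and of the weights with `L^{j(b)}η` (node O ∕ [dict]).  No estimate of Bałaban's is discharged.
-/

noncomputable section

open scoped BigOperators
open NormedSpace Metric Set

namespace Summit.QuantumFields.BalabanUV.T4Continuum.ShellMeasureWilsonRemainderLevelsCov

open Literature.MathematicalPhysics.QuantumFieldTheory.Balaban1983to89
open B11Prop6Scheme (Prop4Hyp)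
open ShellMeasureWilsonGradientTail (plaqWord bonds)
open ShellMeasureLocalGradientTail (locGrad)
open ShellMeasurePlaquetteCubicLocal (fst_mem_bonds)
open ShellMeasurePlaquetteCubicDictionary (V0remCov)
open ShellMeasurePlaquetteCubicCovBinders (norm_V0remCov_le_of_bonds V0remCov_add_single analyticAt_V0remCov)
open ShellMeasureMultiGridNorms (WSup)
open ShellMeasureMultiGridNormsMax (WMax)
open ShellMeasureWilsonRemainderLevels (etaScale hcub_etaScale weighted_locGrad_etaScale_le
  prop4Hyp_locGrad_etaScale_levels prop4Hyp_locGrad_etaScale_levels_max)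
open B7Eq78Linearization (conjR)
open B8Eq146AExpansion (X1 X2 X3 X4 lin adR plaqCovDeriv)
open B8Eq151V2Divergence (brk)
open Summit.QuantumFields.BalabanUV.T4Continuum.ShellMeasureCommutatorVariation (cub dbrk cub_add_smul)
open Summit.QuantumFields.BalabanUV.T4Continuum.ShellMeasureCommutatorLocGrad (ext ext_smul cubT cubT_apply)

export B7Prop1Explicit (Site)

variable {Λ : Type*} {𝔸 : Type*} [NormedRing 𝔸] [NormedAlgebra ℂ 𝔸] [CompleteSpace 𝔸] [Fintype Λ] [DecidableEq Λ]
  [NormOneClass 𝔸] {P : Type*} (Pl : Finset P) (bd : P → Fin 4 → Λ × Bool) (w : Λ → ℝ) (W : P → ℝ)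
  (τ : 𝔸 →L[ℂ] ℂ) {U : Λ → 𝔸ˣ} (hU : ∀ b, ‖(U b : 𝔸)‖ ≤ 1) (hU' : ∀ b, ‖(((U b)⁻¹ : 𝔸ˣ) : 𝔸)‖ ≤ 1)
include hU hU'

/-! ## §0 Two `etaScale` identities for the holder's assembly (generic) -/

omit [CompleteSpace 𝔸] [Fintype Λ] [DecidableEq Λ] [NormOneClass 𝔸] hU hU' in
/-- `etaScale` is additive in the functional: the scaled sum is the sum of the scaled parts (for f5d-b's split
`ord₃ = cub-part + V0remCov`). [folklore] -/
theorem etaScale_add (η : ℝ) (R₁ R₂ : (Λ → 𝔸) → ℂ) (A : Λ → 𝔸) :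
    etaScale η (fun B => R₁ B + R₂ B) A = etaScale η R₁ A + etaScale η R₂ A := by
  simp only [etaScale, mul_add]

omit [CompleteSpace 𝔸] [Fintype Λ] [DecidableEq Λ] [NormOneClass 𝔸] hU hU' in
/-- `etaScale` of a HOMOGENEOUS CUBIC functional is `η⁻¹` times the functional (`η⁻⁴·R(ηA) = η⁻⁴·η³·R(A)`): the
`∇`-part `cubT` (a cubic form in the field) rescales by ONE inverse power of `η`, absorbed by its weight `w` (linear).
[folklore] -/
theorem etaScale_of_cubic {R : (Λ → 𝔸) → ℂ} (hR : ∀ (c : ℂ) (A : Λ → 𝔸), R (c • A) = c ^ 3 * R A) {η : ℝ}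
    (hη : η ≠ 0) (A : Λ → 𝔸) : etaScale η R A = ((η : ℂ))⁻¹ * R A := by
  have hηC : (η : ℂ) ≠ 0 := Complex.ofReal_ne_zero.2 hη
  rw [etaScale, hR]
  field_simp

omit [CompleteSpace 𝔸] [Fintype Λ] [DecidableEq Λ] [NormOneClass 𝔸] hU hU' in
/-- The plaquette covariant derivative, the bracket and its first variation VANISH at the zero field. [folklore] -/
theorem cub_pieces_zero {d : ℕ} (η : ℝ) (U₀ : Site d → Fin d → 𝔸ˣ) (B : Site d → Fin d → 𝔸) (μ ν : Fin d)
    (x : Site d) :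
    plaqCovDeriv η U₀ (0 : Site d → Fin d → 𝔸) μ ν x = 0 ∧ brk U₀ (0 : Site d → Fin d → 𝔸) μ ν x = 0 ∧
      dbrk U₀ (0 : Site d → Fin d → 𝔸) B μ ν x = 0 := by
  refine ⟨?_, ?_, ?_⟩
  · simp [plaqCovDeriv, lin, X1, X2, X3, X4, conjR]
  · simp [brk, X1, X2, X3, X4, conjR, adR]
  · simp [dbrk, X1, X2, X3, X4, conjR, adR]

omit [CompleteSpace 𝔸] [Fintype Λ] [DecidableEq Λ] [NormOneClass 𝔸] hU hU' in
/-- **leaf-05's density `cub` IS A CUBIC FORM in the field**: `cub w τ η U₀ (c • B) p = c³·cub w τ η U₀ B p` (from f3a's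
`cub_add_smul` at the zero field). [folklore] -/
theorem cub_smul {d : ℕ} (w' : ℂ) (η : ℝ) (U₀ : Site d → Fin d → 𝔸ˣ) (B : Site d → Fin d → 𝔸) (c : ℂ) (μ ν : Fin d)
    (x : Site d) : cub w' τ η U₀ (c • B) μ ν x = c ^ 3 * cub w' τ η U₀ B μ ν x := by
  have h := cub_add_smul w' τ η U₀ 0 B c μ ν x
  obtain ⟨h1, h2, h3⟩ := cub_pieces_zero (𝔸 := 𝔸) η U₀ B μ ν x
  rw [zero_add] at h
  rw [h, h1, h2, h3, cub]
  simp only [zero_mul, mul_zero, smul_zero, zero_add, add_zero, map_smul, smul_eq_mul]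
  ring

omit [CompleteSpace 𝔸] [Fintype Λ] [DecidableEq Λ] [NormOneClass 𝔸] hU hU' in
/-- … hence so is f5a's finite-volume functional: `cubT Λ Pl w τ η U₀ (c • A) = c³·cubT Λ Pl w τ η U₀ A`. [folklore] -/
theorem cubT_smul {d : ℕ} (Λ₀ : Finset (Site d × Fin d)) (Pl₀ : Finset (Fin d × Fin d × Site d)) (w' : ℂ) (η : ℝ)
    (U₀ : Site d → Fin d → 𝔸ˣ) (c : ℂ) (A : ↥Λ₀ → 𝔸) :
    cubT Λ₀ Pl₀ w' τ η U₀ (c • A) = c ^ 3 * cubT Λ₀ Pl₀ w' τ η U₀ A := by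
  rw [cubT_apply, cubT_apply, ext_smul, Finset.mul_sum]
  exact Finset.sum_congr rfl fun p _ => cub_smul τ w' η U₀ (ext Λ₀ A) c p.1 p.2.1 p.2.2

omit [CompleteSpace 𝔸] [Fintype Λ] [DecidableEq Λ] [NormOneClass 𝔸] hU hU' in
/-- **THE `∇`-PART IN THE `η`-CURRENCY**: `etaScale η (cubT Λ Pl w τ η U₀) = cubT Λ Pl (η⁻¹·w) τ η U₀` (a cubic form
rescales by `η³`, the currency divides by `η⁴`, the weight `w` is linear) — with f5d-a's `w = iη∕2` the live-level
`∇`-part is `cubT Λ Pl (i∕2) τ η U₀`, to which f5c's `prop4Hyp_locGrad_cubT_levels` applies as stated. [folklore] -/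
theorem etaScale_cubT {d : ℕ} (Λ₀ : Finset (Site d × Fin d)) (Pl₀ : Finset (Fin d × Fin d × Site d)) (w' : ℂ) {η : ℝ}
    (hη : η ≠ 0) (U₀ : Site d → Fin d → 𝔸ˣ) (A : ↥Λ₀ → 𝔸) :
    etaScale η (cubT Λ₀ Pl₀ w' τ η U₀) A = cubT Λ₀ Pl₀ (((η : ℂ))⁻¹ * w') τ η U₀ A := by
  have hηC : (η : ℂ) ≠ 0 := Complex.ofReal_ne_zero.2 hη
  rw [etaScale, cubT_smul, cubT_apply, cubT_apply, Finset.mul_sum, Finset.mul_sum]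
  refine Finset.sum_congr rfl fun p _ => ?_
  simp only [cub]
  field_simp

/-! ## §1 The holder's `∇`-free part `V0remCov` through `ShellMeasureWilsonRemainderLevels` §2 -/

/-- THE HOLDER'S ONE-GRID BOUND IN §2's RAW SHAPE: for a boundary oriented `(+, +, −, −)`,
`‖V0remCov τ U₀ ∂p A‖ ≤ (‖τ‖·248∕3·‖U₀(∂p) − 1‖)·σ³ + (‖τ‖·40∕3)·σ⁴` for `‖A b‖ ≤ σ` on `∂p`, `4σ ≤ 1`
(`norm_V0remCov_le_of_bonds` with `ε₀ := ‖U₀(∂p) − 1‖`). [folklore] -/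
theorem raw_V0remCov (q : Fin 4 → Λ × Bool) (h0 : (q 0).2 = true) (h1 : (q 1).2 = true) (h2 : (q 2).2 = false)
    (h3 : (q 3).2 = false) :
    ∀ (A : Λ → 𝔸) (σ : ℝ), 0 ≤ σ → 4 * σ ≤ 1 → (∀ b ∈ bonds q, ‖A b‖ ≤ σ) →
      ‖V0remCov τ U q A‖ ≤ ‖τ‖ * (248 / 3) * ‖(plaqWord U q (0 : Λ → 𝔸) : 𝔸) - 1‖ * σ ^ 3 + ‖τ‖ * (40 / 3) * σ ^ 4 := by
  intro A σ _ hσ4 hA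
  have h := norm_V0remCov_le_of_bonds τ hU hU' q h0 h1 h2 h3 (A := A)
    (ε₀ := ‖(plaqWord U q (0 : Λ → 𝔸) : 𝔸) - 1‖) le_rfl (fun i => hA _ (fst_mem_bonds q i)) hσ4
  linarith

/-- **(hcub) FOR THE HOLDER'S `∇`-FREE PART, WEIGHT `W p`**: for `0 < η ≤ Wp`, `‖U₀(∂p) − 1‖ ≤ ε₀·(η∕Wp)²`, `0 ≤ ε₀`,
`4ε ≤ 1`, boundary oriented `(+, +, −, −)`:
`∀ A′ σ, 0 ≤ σ → σ < ε∕Wp → (∀ b′ ∈ ∂p, ‖A′ b′‖ ≤ σ) → ‖etaScale η (V0remCov τ U₀ ∂p) A′‖ ≤ (κ∕Wp)·σ³`,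
**`κ = ‖τ‖·(248∕3·ε₀ + 40∕3·ε)`** — (40)'s SHAPE (nothing printed asserted). [folklore] -/
theorem hcub_V0remCov_eta (q : Fin 4 → Λ × Bool) (h0 : (q 0).2 = true) (h1 : (q 1).2 = true) (h2 : (q 2).2 = false)
    (h3 : (q 3).2 = false) {η Wp ε₀ ε : ℝ} (hη : 0 < η) (hηW : η ≤ Wp) (hε₀ : 0 ≤ ε₀)
    (hreg : ‖(plaqWord U q (0 : Λ → 𝔸) : 𝔸) - 1‖ ≤ ε₀ * (η / Wp) ^ 2) (hε4 : 4 * ε ≤ 1) :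
    ∀ (A : Λ → 𝔸) (σ : ℝ), 0 ≤ σ → σ < ε / Wp → (∀ b' ∈ bonds q, ‖A b'‖ ≤ σ) →
      ‖etaScale η (V0remCov τ U q) A‖ ≤ ‖τ‖ * (248 / 3 * ε₀ + 40 / 3 * ε) / Wp * σ ^ 3 := by
  have h := hcub_etaScale (a := ‖τ‖ * (248 / 3) * ‖(plaqWord U q (0 : Λ → 𝔸) : 𝔸) - 1‖)
    (a₀ := ‖τ‖ * (248 / 3) * ε₀) (c := ‖τ‖ * (40 / 3)) hη hηW (by positivity) (by positivity)
    (by nlinarith [norm_nonneg τ]) hε4 (raw_V0remCov τ hU hU' q h0 h1 h2 h3)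
  have e : (‖τ‖ * (248 / 3) * ε₀ + ‖τ‖ * (40 / 3) * ε) = ‖τ‖ * (248 / 3 * ε₀ + 40 / 3 * ε) := by ring
  rw [e] at h
  exact h

/-- **(97) BOND BY BOND FOR THE HOLDER'S `∇`-FREE PART** (`ShellMeasureWilsonRemainderLevels` §2 at
`R p := V0remCov τ U₀ (∂ p)`): boundaries oriented `(+, +, −, −)`, unit-bounded background with
`‖U₀(∂p) − 1‖ ≤ ε₀·(η∕W p)²` for `p ∈ Pl`, weights `η ≤ W p ≤ w b ≤ Lc·W p` on `∂p`, incidence `≤ m`, `4ε ≤ 1`; for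
`w b·‖A′ b‖ ≤ s`, `2s < ε`: `(w b)³·‖locGrad (Σ_p etaScale η (V0remCov τ U₀ (∂ p))) A′ b‖ ≤ 8κ·m·Lc⁴·s²`,
`κ = ‖τ‖·(248∕3·ε₀ + 40∕3·ε)`, every bond, every `τ`. [folklore] -/
theorem weighted_locGrad_V0remCov_eta_le {η ε ε₀ Lc : ℝ} {m : ℕ} (hη : 0 < η) (hε₀ : 0 ≤ ε₀) (hε4 : 4 * ε ≤ 1)
    (hLc1 : 1 ≤ Lc) (hw : ∀ b, 0 < w b)
    (hor : ∀ p ∈ Pl, (bd p 0).2 = true ∧ (bd p 1).2 = true ∧ (bd p 2).2 = false ∧ (bd p 3).2 = false)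
    (hηW : ∀ p ∈ Pl, η ≤ W p)
    (hWw : ∀ p ∈ Pl, ∀ b ∈ bonds (bd p), W p ≤ w b) (hwW : ∀ p ∈ Pl, ∀ b ∈ bonds (bd p), w b ≤ Lc * W p)
    (hreg : ∀ p ∈ Pl, ‖(plaqWord U (bd p) (0 : Λ → 𝔸) : 𝔸) - 1‖ ≤ ε₀ * (η / W p) ^ 2)
    (hm : ∀ b : Λ, (Pl.filter (fun p => b ∈ bonds (bd p))).card ≤ m)
    {A : Λ → 𝔸} {s : ℝ} (hs : 0 ≤ s) (hA : ∀ b, w b * ‖A b‖ ≤ s) (h2s : 2 * s < ε) :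
    ∀ b : Λ, w b ^ 3 * ‖locGrad (fun A => ∑ p ∈ Pl, etaScale η (V0remCov τ U (bd p)) A) A b‖ ≤
      8 * (‖τ‖ * (248 / 3 * ε₀ + 40 / 3 * ε)) * m * Lc ^ 4 * s ^ 2 := by
  have e : ‖τ‖ * (248 / 3 * ε₀ + 40 / 3 * ε) = ‖τ‖ * (248 / 3) * ε₀ + ‖τ‖ * (40 / 3) * ε := by ring
  rw [e]
  exact weighted_locGrad_etaScale_le Pl (fun p => V0remCov τ U (bd p)) (fun p => bonds (bd p)) w W
    (fun p => ‖τ‖ * (248 / 3) * ‖(plaqWord U (bd p) (0 : Λ → 𝔸) : 𝔸) - 1‖) hη (by positivity) (by positivity) hε4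
    hLc1 hw hηW hWw hwW (fun p _ A b hb X => V0remCov_add_single τ (bd p) hU hU' A hb X)
    (fun p _ A => analyticAt_V0remCov τ (bd p) hU hU' A)
    (fun p hp => raw_V0remCov τ hU hU' (bd p) (hor p hp).1 (hor p hp).2.1 (hor p hp).2.2.1 (hor p hp).2.2.2)
    (fun p hp => by nlinarith [norm_nonneg τ, hreg p hp]) hm hs hA h2s

variable [hwf : Fact (∀ b, 0 < w b)]

/-- **(98) FOR THE HOLDER'S `∇`-FREE PART AT THE LIVE LEVELS** (`ShellMeasureWilsonRemainderLevels` §2 at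
`R p := V0remCov τ U₀ (∂ p)`): `Prop4Hyp (…) (8κ·m·Lc⁴) (ε∕2)` from `WSup w 1 𝔸` to `WSup w 3 (𝔸 →L[ℂ] ℂ)`,
`κ = ‖τ‖·(248∕3·ε₀ + 40∕3·ε)`; VOLUME-FREE, k-UNIFORM, every `τ`. [folklore] -/
theorem prop4Hyp_locGrad_V0remCov_eta_levels {η ε ε₀ Lc : ℝ} {m : ℕ} (hη : 0 < η) (hε : 0 < ε) (hε₀ : 0 ≤ ε₀)
    (hε4 : 4 * ε ≤ 1) (hLc1 : 1 ≤ Lc)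
    (hor : ∀ p ∈ Pl, (bd p 0).2 = true ∧ (bd p 1).2 = true ∧ (bd p 2).2 = false ∧ (bd p 3).2 = false)
    (hηW : ∀ p ∈ Pl, η ≤ W p)
    (hWw : ∀ p ∈ Pl, ∀ b ∈ bonds (bd p), W p ≤ w b) (hwW : ∀ p ∈ Pl, ∀ b ∈ bonds (bd p), w b ≤ Lc * W p)
    (hreg : ∀ p ∈ Pl, ‖(plaqWord U (bd p) (0 : Λ → 𝔸) : 𝔸) - 1‖ ≤ ε₀ * (η / W p) ^ 2)
    (hm : ∀ b : Λ, (Pl.filter (fun p => b ∈ bonds (bd p))).card ≤ m) :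
    Prop4Hyp (fun Y : WSup w 1 𝔸 =>
        ((WSup.toPiL w 3).symm (locGrad (fun A => ∑ p ∈ Pl, etaScale η (V0remCov τ U (bd p)) A)
          (WSup.toPiL w 1 Y)) : WSup w 3 (𝔸 →L[ℂ] ℂ)))
      (8 * (‖τ‖ * (248 / 3 * ε₀ + 40 / 3 * ε)) * m * Lc ^ 4) (ε / 2) := by
  have e : ‖τ‖ * (248 / 3 * ε₀ + 40 / 3 * ε) = ‖τ‖ * (248 / 3) * ε₀ + ‖τ‖ * (40 / 3) * ε := by ring
  rw [e]
  exact prop4Hyp_locGrad_etaScale_levels Pl (fun p => V0remCov τ U (bd p)) (fun p => bonds (bd p)) w W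
    (fun p => ‖τ‖ * (248 / 3) * ‖(plaqWord U (bd p) (0 : Λ → 𝔸) : 𝔸) - 1‖) hη hε (by positivity) (by positivity) hε4
    hLc1 hηW hWw hwW (fun p _ A b hb X => V0remCov_add_single τ (bd p) hU hU' A hb X)
    (fun p _ A => analyticAt_V0remCov τ (bd p) hU hU' A)
    (fun p hp => raw_V0remCov τ hU hU' (bd p) (hor p hp).1 (hor p hp).2.1 (hor p hp).2.2.1 (hor p hp).2.2.2)
    (fun p hp => by nlinarith [norm_nonneg τ, hreg p hp]) hm

/-- **(98) FROM `max{|·|_{(−1)}, |∇·|_{(−2)}}` FOR THE HOLDER'S `∇`-FREE PART** (`ShellMeasureWilsonRemainderLevels` §2 at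
`R p := V0remCov τ U₀ (∂ p)`, f2c's source space `WMax w w′ Dv`, ANY `∇`-datum) — the summand of f5d-b's `Prop4Hyp.add`
next to f5c's `ShellMeasureCommutatorLevels.prop4Hyp_locGrad_cubT_levels`. [folklore] -/
theorem prop4Hyp_locGrad_V0remCov_eta_levels_max {Λ' : Type*} [Fintype Λ'] {𝔅 : Type*} [NormedAddCommGroup 𝔅]
    [NormedSpace ℂ 𝔅] (w' : Λ' → ℝ) [Fact (∀ b, 0 < w' b)] (Dv : (Λ → 𝔸) →L[ℂ] (Λ' → 𝔅))
    {η ε ε₀ Lc : ℝ} {m : ℕ} (hη : 0 < η) (hε : 0 < ε) (hε₀ : 0 ≤ ε₀) (hε4 : 4 * ε ≤ 1) (hLc1 : 1 ≤ Lc)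
    (hor : ∀ p ∈ Pl, (bd p 0).2 = true ∧ (bd p 1).2 = true ∧ (bd p 2).2 = false ∧ (bd p 3).2 = false)
    (hηW : ∀ p ∈ Pl, η ≤ W p)
    (hWw : ∀ p ∈ Pl, ∀ b ∈ bonds (bd p), W p ≤ w b) (hwW : ∀ p ∈ Pl, ∀ b ∈ bonds (bd p), w b ≤ Lc * W p)
    (hreg : ∀ p ∈ Pl, ‖(plaqWord U (bd p) (0 : Λ → 𝔸) : 𝔸) - 1‖ ≤ ε₀ * (η / W p) ^ 2)
    (hm : ∀ b : Λ, (Pl.filter (fun p => b ∈ bonds (bd p))).card ≤ m) :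
    Prop4Hyp (fun Y : WMax w w' Dv =>
        ((WSup.toPiL w 3).symm (locGrad (fun A => ∑ p ∈ Pl, etaScale η (V0remCov τ U (bd p)) A)
          (WSup.toPiL w 1 (WMax.toWSupL w w' Dv Y))) : WSup w 3 (𝔸 →L[ℂ] ℂ)))
      (8 * (‖τ‖ * (248 / 3 * ε₀ + 40 / 3 * ε)) * m * Lc ^ 4) (ε / 2) := by
  have e : ‖τ‖ * (248 / 3 * ε₀ + 40 / 3 * ε) = ‖τ‖ * (248 / 3) * ε₀ + ‖τ‖ * (40 / 3) * ε := by ring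
  rw [e]
  exact prop4Hyp_locGrad_etaScale_levels_max Pl (fun p => V0remCov τ U (bd p)) (fun p => bonds (bd p)) w W
    (fun p => ‖τ‖ * (248 / 3) * ‖(plaqWord U (bd p) (0 : Λ → 𝔸) : 𝔸) - 1‖) w' Dv hη hε (by positivity)
    (by positivity) hε4 hLc1 hηW hWw hwW (fun p _ A b hb X => V0remCov_add_single τ (bd p) hU hU' A hb X)
    (fun p _ A => analyticAt_V0remCov τ (bd p) hU hU' A)
    (fun p hp => raw_V0remCov τ hU hU' (bd p) (hor p hp).1 (hor p hp).2.1 (hor p hp).2.2.1 (hor p hp).2.2.2)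
    (fun p hp => by nlinarith [norm_nonneg τ, hreg p hp]) hm

end Summit.QuantumFields.BalabanUV.T4Continuum.ShellMeasureWilsonRemainderLevelsCov

end
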